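import Mathlib

/-!
# Entropy balance (K4), helper 2: densities under a flip duality

Helper file for crux `stmt-AtomisticToContinuum-9122` (`BondHeatUncertainty.LinearResponseFTUR`), line
`lebesgue-flip-duality`, stub `stub_entropyBalance`. Pure measure theory behind "multiply the
generalised detailed balance `φ_* R = E · R` by the density at time `0`":

* `ae_rnDeriv_withDensity_withDensity` — for two densities `a, b` (finite, measurable) w.r.t. a σ-finite
  reference `R` with `a·R ≪ b·R`: `a·R`-a.e. `a ≠ 0`, `b ≠ 0` and `d(a·R)/d(b·R) = a/b`;
* `withDensity_absolutelyContinuous_withDensity` — `a·R ≪ b·R` as soon as `b ≠ 0` `a·R`-a.e.;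
* `flip_duality` (registered sub-goal) — if `φ` is a measurable involution with `φ_* R = E·R`
  (`0 < E < ∞` measurable) and `P = a·R` with `a∘φ ≠ 0` `P`-a.e., then `φ_* P = (E · a∘φ)·R`, `P` and
  `φ_* P` are mutually absolutely continuous, and `P`-a.e.
  `llr(P, φ_* P) = log a - log a∘φ - log E`.
-/

noncomputable section

namespace Summit.AtomisticToContinuum.FouriersLaw.Theorems.LinearResponseFTUR

open MeasureTheory Filter

/-- **Quotient of two densities.** For a σ-finite `R` and finite measurable densities `a, b` with
`a·R ≪ b·R`: `a·R`-almost everywhere `a ≠ 0`, `b ≠ 0` and `d(a·R)/d(b·R) = a / b`. [folklore] -/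
theorem ae_rnDeriv_withDensity_withDensity {Y : Type*} [MeasurableSpace Y] (R : Measure Y)
    [SigmaFinite R] {a b : Y → ENNReal} (ha : Measurable a) (hb : Measurable b) (hat : ∀ y, a y ≠ ⊤)
    (hbt : ∀ y, b y ≠ ⊤) (hac : R.withDensity a ≪ R.withDensity b) :
    ∀ᵐ y ∂(R.withDensity a), a y ≠ 0 ∧ b y ≠ 0 ∧
      (R.withDensity a).rnDeriv (R.withDensity b) y = a y / b y := by
  haveI : SigmaFinite (R.withDensity a) := SigmaFinite.withDensity_of_ne_top' hat
  haveI : SigmaFinite (R.withDensity b) := SigmaFinite.withDensity_of_ne_top' hbt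
  have h1 := Measure.rnDeriv_mul_rnDeriv (κ := R) hac
  have h2 := Measure.rnDeriv_withDensity R hb
  have h3 := Measure.rnDeriv_withDensity R ha
  have hb0 : ∀ᵐ y ∂(R.withDensity a), b y ≠ 0 :=
    hac.ae_le ((ae_withDensity_iff hb).2 (ae_of_all _ fun y hy => hy))
  have ha0 : ∀ᵐ y ∂(R.withDensity a), a y ≠ 0 :=
    (ae_withDensity_iff ha).2 (ae_of_all _ fun y hy => hy)
  have hR : ∀ᵐ y ∂(R), (R.withDensity a).rnDeriv (R.withDensity b) y * b y = a y := by
    filter_upwards [h1, h2, h3] with y hy1 hy2 hy3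
    rw [← hy3, ← hy1, Pi.mul_apply, hy2]
  filter_upwards [ha0, hb0, (withDensity_absolutelyContinuous R a).ae_le hR] with y hya hyb hy
  refine ⟨hya, hyb, ?_⟩
  rw [ENNReal.eq_div_iff hyb (hbt y), mul_comm]
  exact hy

/-- `a·R ≪ b·R` as soon as `b ≠ 0` holds `a·R`-almost everywhere (measurable densities). [folklore] -/
theorem withDensity_absolutelyContinuous_withDensity {Y : Type*} [MeasurableSpace Y] (R : Measure Y)
    {a b : Y → ENNReal} (ha : Measurable a) (hb : Measurable b)
    (h : ∀ᵐ y ∂(R.withDensity a), b y ≠ 0) : R.withDensity a ≪ R.withDensity b := by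
  rw [ae_withDensity_iff ha] at h
  refine Measure.AbsolutelyContinuous.mk fun s hs hs0 => ?_
  rw [withDensity_apply _ hs] at hs0 ⊢
  rw [lintegral_eq_zero_iff hb] at hs0
  rw [lintegral_eq_zero_iff ha]
  filter_upwards [hs0, ae_restrict_of_ae h] with y hy0 hy
  by_contra hne
  exact hy hne hy0

/-- **Densities under a flip duality.** Let `R` be σ-finite, `φ` a measurable involution with
`φ_* R = E · R` for a measurable `E` with `0 < E < ∞`, and `P = a · R` for a finite measurable density
`a` such that `a ∘ φ ≠ 0` `P`-a.e. Then `φ_* P = (E · a∘φ) · R`; `P ≪ φ_* P ≪ P`; and `P`-a.e.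
`log (dP/dφ_*P) = log a - log (a∘φ) - log E`. (For the chain: `R` = image of `Leb ⊗ Wiener` on the
observable space, `φ = Θ̃`, `E = e^{Q_L/T_L + Q_R/T_R}`, `a = ρ(x_0)`; and also `R = Leb`, `φ = Θ`,
`E = 1`, `a = ρ` for `llr(μ, Θ_*μ)`.) Registered sub-goal of crux stmt-AtomisticToContinuum-9122 (stub
`stub_entropyBalance`). [folklore] -/
theorem flip_duality :
    ∀ {Y : Type*} [MeasurableSpace Y] (R : Measure Y) [SigmaFinite R] (φ : Y → Y) (E a : Y → ENNReal),
      Measurable φ → Function.Involutive φ → Measurable E → (∀ y, E y ≠ 0) → (∀ y, E y ≠ ⊤) →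
      R.map φ = R.withDensity E → Measurable a → (∀ y, a y ≠ ⊤) →
      (∀ᵐ y ∂(R.withDensity a), a (φ y) ≠ 0) →
      (R.withDensity a).map φ = R.withDensity (fun y => E y * a (φ y)) ∧
      R.withDensity a ≪ (R.withDensity a).map φ ∧ (R.withDensity a).map φ ≪ R.withDensity a ∧
      ∀ᵐ y ∂(R.withDensity a), llr (R.withDensity a) ((R.withDensity a).map φ) y =
        Real.log (a y).toReal - Real.log (a (φ y)).toReal - Real.log (E y).toReal := by
  intro Y _ R _ φ E a hφ hφφ hE hE0 hEt hdual ha hat hnull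
  set P := R.withDensity a with hP
  set b : Y → ENNReal := fun y => E y * a (φ y) with hb
  have hbm : Measurable b := hE.mul (ha.comp hφ)
  have hbt : ∀ y, b y ≠ ⊤ := fun y => ENNReal.mul_ne_top (hEt y) (hat _)
  -- (i) the density of the flipped measure
  have hmap : P.map φ = R.withDensity b := by
    refine Measure.ext_of_lintegral _ fun G hG => ?_
    have hGφ : Measurable fun y => G (φ y) := hG.comp hφ
    have haG : Measurable fun z => a (φ z) * G z := (ha.comp hφ).mul hG
    calc ∫⁻ y, G y ∂(P.map φ) = ∫⁻ y, G (φ y) ∂P := lintegral_map hG hφ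
      _ = ∫⁻ y, a y * G (φ y) ∂(R) := by
          rw [hP, lintegral_withDensity_eq_lintegral_mul R ha hGφ]
          rfl
      _ = ∫⁻ y, (fun z => a (φ z) * G z) (φ y) ∂(R) := by
          refine lintegral_congr fun y => ?_
          simp only [hφφ y]
      _ = ∫⁻ z, a (φ z) * G z ∂(R.map φ) := (lintegral_map haG hφ).symm
      _ = ∫⁻ z, E z * (a (φ z) * G z) ∂(R) := by
          rw [hdual, lintegral_withDensity_eq_lintegral_mul R hE haG]
          rfl
      _ = ∫⁻ y, G y ∂(R.withDensity b) := by
          rw [lintegral_withDensity_eq_lintegral_mul R hbm hG]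
          refine lintegral_congr fun y => ?_
          simp only [Pi.mul_apply, hb]
          ring
  -- (ii) mutual absolute continuity
  have hPb : ∀ᵐ y ∂P, b y ≠ 0 := by
    filter_upwards [hnull] with y hy
    exact mul_ne_zero (hE0 y) hy
  have hac1 : P ≪ P.map φ := by
    rw [hmap]
    exact withDensity_absolutelyContinuous_withDensity R ha hbm hPb
  have hac2 : P.map φ ≪ P := by
    have h' : ∀ᵐ y ∂(P.map φ), a y ≠ 0 :=
      (ae_map_iff hφ.aemeasurable (ha (measurableSet_singleton 0).compl)).2 hnull
    rw [hmap] at h' ⊢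
    exact withDensity_absolutelyContinuous_withDensity R hbm ha h'
  -- (iii) the log-likelihood ratio
  have hq := ae_rnDeriv_withDensity_withDensity R ha hbm hat hbt (hmap ▸ hac1)
  refine ⟨hmap, hac1, hac2, ?_⟩
  rw [hmap]
  filter_upwards [hq] with y hy
  obtain ⟨ha0, hb0, hy⟩ := hy
  have ha' : (a y).toReal ≠ 0 := ENNReal.toReal_ne_zero.2 ⟨ha0, hat y⟩
  have haφ : (a (φ y)).toReal ≠ 0 := ENNReal.toReal_ne_zero.2 ⟨(mul_ne_zero_iff.1 hb0).2, hat _⟩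
  have hE' : (E y).toReal ≠ 0 := ENNReal.toReal_ne_zero.2 ⟨hE0 y, hEt y⟩
  show Real.log (P.rnDeriv (R.withDensity b) y).toReal = _
  rw [hy, ENNReal.toReal_div, hb, ENNReal.toReal_mul, Real.log_div ha' (mul_ne_zero hE' haφ),
    Real.log_mul hE' haφ]
  ring

end Summit.AtomisticToContinuum.FouriersLaw.Theorems.LinearResponseFTUR

end
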